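import Literature.AlgebraicTopology.FundamentalGroup.PosDetMatrixFundamentalGroup
import Literature.AlgebraicTopology.Homotopy.HomotopyGroupsGeneralPosition
import Mathlib.LinearAlgebra.Matrix.SchurComplement
import Mathlib.Analysis.SpecialFunctions.Trigonometric.Basic
import HarnessLib

/-!
# The rotation loop is essential in `GLₙ(ℝ)` for every `n ≥ 3` — proved

Topic `Literature/AlgebraicTopology/FundamentalGroup`. The classical fact that the loop of
rotations `θ ↦ R_θ ⊕ 1ₙ₋₂` (one full turn in a coordinate plane) is **not** null-homotopic in
`GLₙ(ℝ)` (equivalently in `SO(n)`, or `GL⁺ₙ(ℝ)`) for any `n ≥ 3`: it represents the generator of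
`π₁(SO(n)) ≅ ℤ/2` (Hatcher, *Algebraic Topology* (2002), §3.D: "`SO(3)` is homeomorphic to `ℝP³`
… `π₁(SO(n)) ≅ ℤ₂` for `n ≥ 3`"; the stability `π₁(SO(n)) ≅ π₁(SO(n+1))`, `n ≥ 3`, from the long
exact sequence of the fibration `SO(n) → SO(n+1) → Sⁿ`, loc. cit. Example 4.55; Steenrod,
*The Topology of Fibre Bundles* (1951), §22). Everything here is PROVED; the file adds no named
fact. It is written for the proof that `ℂℙ²` is not spin
(`Literature/Topology/FourManifolds/SPC4SpinCP2Proofs.lean`: the clutching function of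
`Tℂℙ²|_{ℂℙ¹} ⊕ ℝ` is this loop in `GL₅(ℝ)`), and is of independent use (framings of stabilised
bundles over surfaces).

## Main statements

* `RotLoop.square_false n` — **square form**: there is no continuous
  `G : I² → GLₙ₊₃(ℝ)` (matrices with `det ≠ 0`) whose boundary values are
  `rotBlock n (bc y) (bs y)`, i.e. one full turn of the coordinate rotation `rotY` (stabilised by
  `1`'s) along the bottom edge and the identity on the three other edges.
* `RotLoop.not_homotopic_rotLoop_refl n` — **loop form**: the loop
  `x ↦ rotY (cos 2πx) (sin 2πx) ⊕ 1ₙ` in `GLₙ₊₃(ℝ)` is not homotopic rel end points to the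
  constant loop.
* `RotLoop.disc_false n` — **disc form**: no continuous `G : ℂ → GLₙ₊₃(ℝ)` restricts on the unit
  circle to `c + is ↦ rotBlock n c s`.

## Proof

By induction on the dimension, entirely inside the tree's proved infrastructure:

* *Base case `GL₃(ℝ)`* (`RotLoop.base`): a null-homotopy `C : I² → GL₃(ℝ)` has `det C > 0`
  (connectedness), so the Gram–Schmidt retraction `GL⁺(3, ℝ) → SO(3)`
  (`GLPos3.retr`, `PosDetMatrixFundamentalGroup.lean`), which fixes the boundary rotations, gives
  a null-homotopy rel end points in `SO(3)` of `x ↦ rotY (cos 2πx) (sin 2πx)`. Its lift through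
  the covering `S³ → SO(3)` (`isCoveringMap_rotHom`, `RotationGroupSO3.lean`) starting at `1` is
  the explicit path `x ↦ cos(πx) + sin(πx) j` (half-angle formulas) ending at `-1 ≠ 1`, while
  homotopic paths lift to paths with the same end point (Mathlib's
  `IsCoveringMap.liftPath_apply_one_eq_of_homotopicRel`, Hatcher Prop. 1.30).
* *Peeling step `GLₘ₊₁(ℝ) → GLₘ(ℝ)`, `m ≥ 3`* (`RotLoop.peel`): if `G : I² → GLₘ₊₁(ℝ)` has
  boundary values `B₀ ⊕ 1`, its last column `u` is a map `(I², ∂I²) → (ℝᵐ⁺¹ ∖ 0, e)`; since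
  `π₂(Sᵐ) = 0` (`Literature.AlgebraicTopology.Homotopy.subsingleton_homotopyGroup_sphere`,
  general position) it is null-homotopic rel `∂I²`; *frame transport* along this null-homotopy
  (`RotLoop.exists_transport`: finite products of the elementary matrices
  `τ(v, w) = 1 + (w - v)vᵀ/|v|²`, `τ(v, w) v = w`, over a partition fine enough that consecutive
  columns make an acute angle — a hands-on path lifting for `GLₘ₊₁(ℝ) → ℝᵐ⁺¹ ∖ 0`) produces a
  continuous `T` with `T = 1` on `∂I²` and `T G e ∈ ℝ₊ e`; the upper left block of `T G` is a
  null-homotopy in `GLₘ(ℝ)` of `B₀` (Laplace expansion along the last column).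
* The induction `RotLoop.square_false` and the reformulations as a loop (`Path.Homotopic`) and
  as a disc extension (composition with `y ↦ (1 - y₁) e^{2π i y₀} + y₁ : I² → D²`).

## References

* A. Hatcher, *Algebraic Topology*, Cambridge University Press (2002), §1.3 Prop. 1.30
  (homotopy lifting), §3.D (`SO(3) ≈ ℝP³`, the universal cover `S³ → SO(3)`, `π₁(SO(n)) = ℤ₂`),
  §4.1 Cor. 4.9 (`πᵢ(Sⁿ) = 0`, `i < n`), §4.2 Example 4.55 (stability for `O(n)`). [HatcherAT2002]
* N. Steenrod, *The Topology of Fibre Bundles*, Princeton University Press (1951), §7, §12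
  (local cross-sections of `GLₙ → ℝⁿ ∖ 0`), §22 (homotopy groups of the rotation groups).
-/

noncomputable section

open Set Function Matrix Topology unitInterval

namespace Literature.AlgebraicTopology.FundamentalGroup

namespace RotLoop

/-! ### Frame transport along a homotopy of a nowhere-vanishing vector field -/

variable {n : ℕ}

/-- The squared length of a real vector is nonnegative. [folklore] -/
theorem dotProduct_self_nonneg (v : Fin n → ℝ) : 0 ≤ v ⬝ᵥ v :=
  Finset.sum_nonneg fun i _ ↦ mul_self_nonneg (v i)

/-- A nonzero real vector has positive squared length. [folklore] -/
theorem dotProduct_self_pos {v : Fin n → ℝ} (hv : v ≠ 0) : 0 < v ⬝ᵥ v :=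
  lt_of_le_of_ne (dotProduct_self_nonneg v) fun h ↦ hv (dotProduct_self_eq_zero.1 h.symm)

/-- The elementary **transvection-like matrix** `τ(v, w) = 1 + (w - v) vᵀ / (vᵀ v)`, which maps `v`
to `w` and is invertible as soon as `⟨v, w⟩ > 0`; the building block of the frame transport
(Steenrod, *The Topology of Fibre Bundles*, §12: the bundle `GLₙ(ℝ) → ℝⁿ ∖ 0` has local
cross-sections). [folklore] -/
def transvec (v w : Fin n → ℝ) : Matrix (Fin n) (Fin n) ℝ :=
  1 + vecMulVec (w - v) ((v ⬝ᵥ v)⁻¹ • v)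

/-- `τ(v, w) v = w` for `v ≠ 0`. [folklore] -/
theorem transvec_mulVec_self {v : Fin n → ℝ} (hv : v ≠ 0) (w : Fin n → ℝ) :
    transvec v w *ᵥ v = w := by
  have hvv : v ⬝ᵥ v ≠ 0 := (dotProduct_self_pos hv).ne'
  rw [transvec, add_mulVec, one_mulVec, vecMulVec_mulVec, smul_dotProduct, smul_eq_mul,
    inv_mul_cancel₀ hvv]
  simp

/-- `τ(v, v) = 1`. [folklore] -/
theorem transvec_self (v : Fin n → ℝ) : transvec v v = 1 := by
  simp [transvec]

/-- `det τ(v, w) = ⟨v, w⟩ / ⟨v, v⟩` (matrix determinant lemma). [folklore] -/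
theorem det_transvec {v : Fin n → ℝ} (hv : v ≠ 0) (w : Fin n → ℝ) :
    (transvec v w).det = (v ⬝ᵥ w) / (v ⬝ᵥ v) := by
  have hvv : v ⬝ᵥ v ≠ 0 := (dotProduct_self_pos hv).ne'
  rw [transvec, vecMulVec_eq (Fin 1), det_one_add_replicateCol_mul_replicateRow, smul_dotProduct,
    dotProduct_sub, smul_eq_mul, dotProduct_comm v w]
  field_simp
  ring

/-- `τ(a(z), b(z))` depends continuously on `z` where `a(z) ≠ 0`. [folklore] -/
theorem continuous_transvec {X : Type*} [TopologicalSpace X] {a b : X → Fin n → ℝ}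
    (ha : Continuous a) (hb : Continuous b) (h0 : ∀ z, a z ≠ 0) :
    Continuous fun z ↦ transvec (a z) (b z) := by
  unfold transvec
  refine continuous_const.add (Continuous.matrix_vecMulVec (hb.sub ha) ?_)
  have hinv : Continuous fun z ↦ (a z ⬝ᵥ a z)⁻¹ :=
    Continuous.inv₀ (by fun_prop) fun z ↦ (dotProduct_self_pos (h0 z)).ne'
  exact hinv.smul ha

/-- Auxiliary compactness statement: for a continuous nowhere-vanishing `H : I × K → ℝⁿ` on a
compact `K`, there is `δ > 0` with `⟨H(s, z), H(t, z)⟩ > 0` whenever `|s - t| < δ`. [folklore] -/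
theorem exists_delta_dotProduct_pos {K : Type*} [TopologicalSpace K] [CompactSpace K]
    {H : I × K → (Fin n → ℝ)} (hH : Continuous H) (h0 : ∀ p, H p ≠ 0) :
    ∃ δ > 0, ∀ (s t : I) (z : K), |(s : ℝ) - t| < δ → 0 < H (s, z) ⬝ᵥ H (t, z) := by
  -- the bad set is compact and avoids the diagonal
  let S : Set (I × I × K) := {p | H (p.1, p.2.2) ⬝ᵥ H (p.2.1, p.2.2) ≤ 0}
  have hScl : IsClosed S := by
    apply isClosed_le _ continuous_const
    have h1 : Continuous fun p : I × I × K ↦ H (p.1, p.2.2) := hH.comp (by fun_prop)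
    have h2 : Continuous fun p : I × I × K ↦ H (p.2.1, p.2.2) := hH.comp (by fun_prop)
    exact continuous_finsetSum _ fun i _ ↦
      ((continuous_apply i).comp h1).mul ((continuous_apply i).comp h2)
  have hScp : IsCompact S := hScl.isCompact
  rcases S.eq_empty_or_nonempty with hS | hS
  · refine ⟨1, one_pos, fun s t z _ ↦ ?_⟩
    by_contra h
    have : (s, t, z) ∈ S := not_lt.1 h
    rw [hS] at this
    exact this
  · have hf : Continuous fun p : I × I × K ↦ |(p.1 : ℝ) - p.2.1| := by fun_prop
    obtain ⟨p₀, hp₀, hmin⟩ := hScp.exists_isMinOn hS hf.continuousOn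
    refine ⟨|(p₀.1 : ℝ) - p₀.2.1|, ?_, fun s t z hst ↦ ?_⟩
    · rcases (abs_nonneg ((p₀.1 : ℝ) - p₀.2.1)).lt_or_eq with h | h
      · exact h
      · exfalso
        have heq : p₀.1 = p₀.2.1 := Subtype.ext (by
          have := abs_eq_zero.1 h.symm
          linarith)
        have hle : H (p₀.1, p₀.2.2) ⬝ᵥ H (p₀.2.1, p₀.2.2) ≤ 0 := hp₀
        rw [heq] at hle
        exact absurd hle (not_le.2 (dotProduct_self_pos (h0 _)))
    · by_contra h
      have hmem : (s, t, z) ∈ S := not_lt.1 h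
      have := hmin hmem
      simp only at this
      exact absurd this (not_le.2 hst)

/-- **Frame transport along a homotopy.** Let `H : I × K → ℝⁿ` be continuous and nowhere zero on a
compact space `K`. There is a continuous family of invertible matrices `T(z)` with
`T(z) H(0, z) = H(1, z)`, equal to `1` wherever `H(·, z)` is constant: the product of the
elementary matrices `τ(H(tₖ, z), H(tₖ₊₁, z))` over a fine enough partition `0 = t₀ < … < t_N = 1`
(path lifting in the bundle `GLₙ(ℝ) → ℝⁿ ∖ 0`, Steenrod, *The Topology of Fibre Bundles*, §7.4,
§12). [folklore] -/
theorem exists_transport {K : Type*} [TopologicalSpace K] [CompactSpace K]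
    {H : I × K → (Fin n → ℝ)} (hH : Continuous H) (h0 : ∀ p, H p ≠ 0) :
    ∃ T : K → Matrix (Fin n) (Fin n) ℝ, Continuous T ∧ (∀ z, (T z).det ≠ 0) ∧
      (∀ z, T z *ᵥ H (0, z) = H (1, z)) ∧ ∀ z, (∀ t, H (t, z) = H (0, z)) → T z = 1 := by
  obtain ⟨δ, hδ, hpos⟩ := exists_delta_dotProduct_pos hH h0
  obtain ⟨N, hN⟩ := exists_nat_one_div_lt hδ
  -- the partition points `tₖ = min (k / (N + 1)) 1`
  let tk : ℕ → I := fun k ↦ ⟨min ((k : ℝ) / (N + 1)) 1,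
    le_min (by positivity) zero_le_one, min_le_right _ _⟩
  have htk0 : tk 0 = 0 := Subtype.ext (by simp [tk])
  have htkN : tk (N + 1) = 1 := Subtype.ext (by
    simp only [tk, Nat.cast_add, Nat.cast_one]
    rw [div_self (by positivity), min_self]; rfl)
  have hstep : ∀ k, |(tk k : ℝ) - tk (k + 1)| < δ := by
    intro k
    have hNpos : (0 : ℝ) < N + 1 := by positivity
    have h1 : (tk k : ℝ) ≤ tk (k + 1) := by
      simp only [tk, Nat.cast_add, Nat.cast_one]
      exact min_le_min_right _ (div_le_div_of_nonneg_right (by linarith) hNpos.le)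
    have h2 : (tk (k + 1) : ℝ) ≤ tk k + 1 / (N + 1) := by
      simp only [tk, Nat.cast_add, Nat.cast_one]
      rcases le_or_gt ((k : ℝ) / (N + 1)) 1 with hk | hk
      · rw [min_eq_left hk]
        refine (min_le_left _ _).trans_eq ?_
        field_simp
      · rw [min_eq_right hk.le]
        refine (min_le_right _ _).trans ?_
        have : (0 : ℝ) ≤ 1 / (N + 1) := by positivity
        linarith
    rw [abs_sub_comm, abs_of_nonneg (by linarith)]
    linarith
  -- the partial products
  let P : ℕ → K → Matrix (Fin n) (Fin n) ℝ := fun k ↦ Nat.rec (fun _ ↦ 1)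
    (fun k Pk z ↦ transvec (H (tk k, z)) (H (tk (k + 1), z)) * Pk z) k
  have hP0 : ∀ z, P 0 z = 1 := fun z ↦ rfl
  have hPsucc : ∀ k z, P (k + 1) z = transvec (H (tk k, z)) (H (tk (k + 1), z)) * P k z :=
    fun k z ↦ rfl
  have hPcont : ∀ k, Continuous (P k) := by
    intro k
    induction k with
    | zero => exact continuous_const
    | succ k ih =>
      change Continuous fun z ↦ transvec (H (tk k, z)) (H (tk (k + 1), z)) * P k z
      exact (continuous_transvec (hH.comp (by fun_prop)) (hH.comp (by fun_prop))
        fun z ↦ h0 _).mul ih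
  have hPdet : ∀ k z, (P k z).det ≠ 0 := by
    intro k
    induction k with
    | zero => intro z; simp [hP0]
    | succ k ih =>
      intro z
      rw [hPsucc, det_mul, det_transvec (h0 _)]
      refine mul_ne_zero (div_pos (hpos _ _ _ (hstep k)) (dotProduct_self_pos (h0 _))).ne' (ih z)
  have hPvec : ∀ k z, P k z *ᵥ H (0, z) = H (tk k, z) := by
    intro k
    induction k with
    | zero => intro z; rw [hP0, one_mulVec, htk0]
    | succ k ih =>
      intro z
      rw [hPsucc, ← mulVec_mulVec, ih, transvec_mulVec_self (h0 _)]
  have hPone : ∀ k z, (∀ t, H (t, z) = H (0, z)) → P k z = 1 := by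
    intro k
    induction k with
    | zero => intro z _; rw [hP0]
    | succ k ih =>
      intro z hz
      rw [hPsucc, ih z hz, hz (tk k), hz (tk (k + 1)), transvec_self, Matrix.mul_one]
  refine ⟨P (N + 1), hPcont (N + 1), hPdet (N + 1), fun z ↦ ?_, hPone (N + 1)⟩
  have h := hPvec (N + 1) z
  rwa [htkN] at h

/-! ### The block embedding `B ↦ B ⊕ 1` -/

/-- `embed B = B ⊕ 1`: the block-diagonal matrix with `B` in the upper left `n × n` corner, `1` in
the last diagonal entry and `0` elsewhere in the last row and column (the stabilisation
`GLₙ(ℝ) ⊂ GLₙ₊₁(ℝ)`). [folklore] -/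
def embed (B : Matrix (Fin n) (Fin n) ℝ) : Matrix (Fin (n + 1)) (Fin (n + 1)) ℝ :=
  Matrix.of fun i j ↦
    if hi : i = Fin.last n then (if j = Fin.last n then 1 else 0)
    else if hj : j = Fin.last n then 0 else B (i.castPred hi) (j.castPred hj)

/-- Upper left block of `embed B`. [folklore] -/
@[simp] theorem embed_castSucc_castSucc (B : Matrix (Fin n) (Fin n) ℝ) (i j : Fin n) :
    embed B i.castSucc j.castSucc = B i j := by
  simp [embed, Fin.castSucc_ne_last]

/-- Last column of `embed B` above the corner vanishes. [folklore] -/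
@[simp] theorem embed_castSucc_last (B : Matrix (Fin n) (Fin n) ℝ) (i : Fin n) :
    embed B i.castSucc (Fin.last n) = 0 := by
  simp [embed, Fin.castSucc_ne_last]

/-- Last row of `embed B` left of the corner vanishes. [folklore] -/
@[simp] theorem embed_last_castSucc (B : Matrix (Fin n) (Fin n) ℝ) (j : Fin n) :
    embed B (Fin.last n) j.castSucc = 0 := by
  simp [embed, Fin.castSucc_ne_last]

/-- The corner entry of `embed B` is `1`. [folklore] -/
@[simp] theorem embed_last_last (B : Matrix (Fin n) (Fin n) ℝ) :
    embed B (Fin.last n) (Fin.last n) = 1 := by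
  simp [embed]

/-- The last column of `embed B` is the last basis vector. [folklore] -/
theorem embed_apply_last (B : Matrix (Fin n) (Fin n) ℝ) (i : Fin (n + 1)) :
    embed B i (Fin.last n) = if i = Fin.last n then 1 else 0 := by
  induction i using Fin.lastCases with
  | last => simp
  | cast i => simp [Fin.castSucc_ne_last]

/-- The last row of `embed B` is the last basis vector. [folklore] -/
theorem embed_last_apply (B : Matrix (Fin n) (Fin n) ℝ) (j : Fin (n + 1)) :
    embed B (Fin.last n) j = if j = Fin.last n then 1 else 0 := by
  simp [embed]

/-- The upper left block of `embed B` is `B`. [folklore] -/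
@[simp] theorem submatrix_embed (B : Matrix (Fin n) (Fin n) ℝ) :
    (embed B).submatrix Fin.castSucc Fin.castSucc = B := by
  ext i j
  simp

/-- `embed 1 = 1`. [folklore] -/
@[simp] theorem embed_one : embed (1 : Matrix (Fin n) (Fin n) ℝ) = 1 := by
  ext i j
  induction i using Fin.lastCases with
  | last =>
    induction j using Fin.lastCases with
    | last => simp
    | cast j => rw [embed_last_castSucc, Matrix.one_apply_ne (Fin.castSucc_ne_last j).symm]
  | cast i =>
    induction j using Fin.lastCases with
    | last => simp [Fin.castSucc_ne_last]
    | cast j => simp [Matrix.one_apply]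

/-- `embed` is continuous. [folklore] -/
theorem continuous_embed : Continuous (embed : Matrix (Fin n) (Fin n) ℝ → _) := by
  refine continuous_matrix fun i j ↦ ?_
  induction i using Fin.lastCases with
  | last => simp only [embed_last_apply]; exact continuous_const
  | cast i =>
    induction j using Fin.lastCases with
    | last => simp only [embed_castSucc_last]; exact continuous_const
    | cast j => simp only [embed_castSucc_castSucc]; exact continuous_id.matrix_elem i j

/-- Laplace expansion along a last column equal to a multiple of the last basis vector:
`det A = A_{nn} · det (upper left block)`. [folklore] -/
theorem det_eq_of_last_column {A : Matrix (Fin (n + 1)) (Fin (n + 1)) ℝ}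
    (hA : ∀ i : Fin n, A i.castSucc (Fin.last n) = 0) :
    A.det = A (Fin.last n) (Fin.last n) * (A.submatrix Fin.castSucc Fin.castSucc).det := by
  rw [det_succ_column A (Fin.last n), Finset.sum_eq_single (Fin.last n)]
  · have h : (-1 : ℝ) ^ ((Fin.last n : ℕ) + (Fin.last n : ℕ)) = 1 :=
      Even.neg_one_pow ⟨n, by simp⟩
    rw [h, one_mul, Fin.succAbove_last]
  · intro i _ hi
    obtain ⟨i, rfl⟩ := Fin.exists_castSucc_eq.2 hi
    rw [hA i, mul_zero, zero_mul]
  · simp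

/-- `det (embed B) = det B`. [folklore] -/
@[simp] theorem det_embed (B : Matrix (Fin n) (Fin n) ℝ) : (embed B).det = B.det := by
  rw [det_eq_of_last_column (embed_castSucc_last B), embed_last_last, one_mul, submatrix_embed]

/-! ### The peeling step: from `GLₙ₊₁(ℝ)` to `GLₙ(ℝ)` through `π₂(Sⁿ) = 0` -/

/-- **Peeling off a trivial direction.** Let `G : I² → GLₙ₊₁(ℝ)` be continuous with values
`embed (B₀ y) = B₀ y ⊕ 1` on the boundary of the square, `n ≥ 3`. Then there is a continuous
`B : I² → GLₙ(ℝ)` with the boundary values `B₀`. Proof: the last column `u = G eₙ` is a map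
`(I², ∂I²) → (ℝⁿ⁺¹ ∖ 0, eₙ)`, null-homotopic rel `∂I²` since `π₂(Sⁿ) = 0`
(`Literature.AlgebraicTopology.Homotopy.subsingleton_homotopyGroup_sphere`); transporting frames
along such a null-homotopy (`exists_transport`) multiplies `G` by a continuous `T` with `T = 1`
on `∂I²` so that `T G eₙ ∈ ℝ₊ eₙ`, and the upper left block of `T G` is the required `B`. This is
the injectivity half of the stability `π₁(GLₙ(ℝ)) ≅ π₁(GLₙ₊₁(ℝ))`, `n ≥ 3`, read through the
fibration `GLₙ(ℝ) → GLₙ₊₁(ℝ) → ℝⁿ⁺¹ ∖ 0` (Steenrod, *The Topology of Fibre Bundles*, §17.7,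
§22; Hatcher, *Algebraic Topology*, Example 4.55). [cite: HatcherAT2002, §4.2 Example 4.55 (πᵢ(O(n)) → πᵢ(O(n+1)) is an isomorphism for i < n − 1)] -/
theorem peel (hn : 3 ≤ n) {G : (Fin 2 → I) → Matrix (Fin (n + 1)) (Fin (n + 1)) ℝ}
    (hG : Continuous G) (hdet : ∀ y, (G y).det ≠ 0)
    {B₀ : (Fin 2 → I) → Matrix (Fin n) (Fin n) ℝ}
    (hbd : ∀ y ∈ Cube.boundary (Fin 2), G y = embed (B₀ y)) :
    ∃ B : (Fin 2 → I) → Matrix (Fin n) (Fin n) ℝ, Continuous B ∧ (∀ y, (B y).det ≠ 0) ∧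
      ∀ y ∈ Cube.boundary (Fin 2), B y = B₀ y := by
  -- the last column `u` and the last basis vector `e`
  let e : Fin (n + 1) → ℝ := Pi.single (Fin.last n) 1
  have he : ‖e‖ = 1 := by simp [e, Pi.norm_single]
  let u : (Fin 2 → I) → Fin (n + 1) → ℝ := fun y i ↦ G y i (Fin.last n)
  have hu : Continuous u := continuous_pi fun i ↦ hG.matrix_elem i (Fin.last n)
  have hu0 : ∀ y, u y ≠ 0 := by
    intro y h
    apply hdet y
    exact det_eq_zero_of_column_eq_zero (Fin.last n) fun i ↦ congrFun h i
  have hubd : ∀ y ∈ Cube.boundary (Fin 2), u y = e := by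
    intro y hy
    ext i
    simp only [u, hbd y hy, embed_apply_last, e, Pi.single_apply]
  have hnorm : ∀ y, 0 < ‖u y‖ := fun y ↦ norm_pos_iff.2 (hu0 y)
  -- the normalised column as a map to the unit sphere, a `2`-loop based at `e`
  let S := Metric.sphere (0 : Fin (n + 1) → ℝ) 1
  have heS : e ∈ S := by simp [S, he]
  let un : (Fin 2 → I) → Fin (n + 1) → ℝ := fun y ↦ ‖u y‖⁻¹ • u y
  have hun : Continuous un := ((hu.norm).inv₀ fun y ↦ (hnorm y).ne').smul hu
  have hunS : ∀ y, un y ∈ S := fun y ↦ by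
    simp [un, S, norm_smul, (hnorm y).ne']
  let uS : C(Fin 2 → I, S) := ⟨fun y ↦ ⟨un y, hunS y⟩, hun.subtype_mk hunS⟩
  have huS : ∀ y, ((uS y : S) : Fin (n + 1) → ℝ) = ‖u y‖⁻¹ • u y := fun _ ↦ rfl
  have huSbd : ∀ y ∈ Cube.boundary (Fin 2), uS y = ⟨e, heS⟩ := by
    intro y hy
    apply Subtype.ext
    rw [huS, hubd y hy, he, inv_one, one_smul]
  let gl : GenLoop (Fin 2) S ⟨e, heS⟩ := ⟨uS, huSbd⟩
  -- `π₂(Sⁿ) = 0`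
  have hsub : Subsingleton (HomotopyGroup (Fin 2) S ⟨e, heS⟩) := by
    apply Literature.AlgebraicTopology.Homotopy.subsingleton_homotopyGroup_sphere
    rw [Module.finrank_fin_fun]
    omega
  obtain ⟨F⟩ : GenLoop.Homotopic gl GenLoop.const :=
    Literature.AlgebraicTopology.Homotopy.subsingleton_homotopyGroup_iff.1 hsub gl
  -- the homotopy of the last column, in `ℝⁿ⁺¹ ∖ 0`
  let H : I × (Fin 2 → I) → Fin (n + 1) → ℝ := fun p ↦ ((F p : S) : Fin (n + 1) → ℝ)
  have hH : Continuous H := continuous_subtype_val.comp F.continuous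
  have hH0 : ∀ p, H p ≠ 0 := fun p ↦ ne_zero_of_mem_unit_sphere (F p)
  have hHzero : ∀ y, H (0, y) = ‖u y‖⁻¹ • u y := by
    intro y
    simp only [H, F.apply_zero]
    rfl
  have hHone : ∀ y, H (1, y) = e := by
    intro y
    simp only [H, F.apply_one]
    rfl
  have hHbd : ∀ y ∈ Cube.boundary (Fin 2), ∀ t, H (t, y) = H (0, y) := by
    intro y hy t
    simp only [H]
    rw [F.eq_fst t hy, F.eq_fst 0 hy]
  obtain ⟨T, hT, hTdet, hTvec, hTone⟩ := exists_transport hH hH0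
  -- the corrected frame `T G` has last column `‖u‖ e`
  let G' : (Fin 2 → I) → Matrix (Fin (n + 1)) (Fin (n + 1)) ℝ := fun y ↦ T y * G y
  have hG' : Continuous G' := hT.mul hG
  have hG'col : ∀ y i, G' y i (Fin.last n) = ‖u y‖ * e i := by
    intro y i
    have h1 : G' y i (Fin.last n) = (T y *ᵥ u y) i := by
      simp [G', Matrix.mul_apply, mulVec, dotProduct, u]
    have h2 : T y *ᵥ u y = ‖u y‖ • e := by
      have h3 := hTvec y
      rw [hHzero, hHone, mulVec_smul] at h3
      rw [← h3, smul_smul, mul_inv_cancel₀ (hnorm y).ne', one_smul]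
    rw [h1, h2, Pi.smul_apply, smul_eq_mul]
  refine ⟨fun y ↦ (G' y).submatrix Fin.castSucc Fin.castSucc, hG'.matrix_submatrix _ _,
    fun y ↦ ?_, fun y hy ↦ ?_⟩
  · have h := det_eq_of_last_column (A := G' y) (fun i ↦ by
      rw [hG'col]; simp [e, Fin.castSucc_ne_last])
    have hd : (G' y).det ≠ 0 := by
      rw [show G' y = T y * G y from rfl, det_mul]
      exact mul_ne_zero (hTdet y) (hdet y)
    rw [h] at hd
    exact right_ne_zero_of_mul hd
  · show (G' y).submatrix Fin.castSucc Fin.castSucc = B₀ y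
    rw [show G' y = T y * G y from rfl, hTone y (hHbd y hy), Matrix.one_mul, hbd y hy,
      submatrix_embed]

/-! ### The boundary data on the square -/

/-- The point `(x, t)` of the square `I²` as an element of `Fin 2 → I`. [folklore] -/
def sq (x t : I) : Fin 2 → I := ![x, t]

/-- First coordinate of `sq x t`. [folklore] -/
@[simp] theorem sq_zero (x t : I) : sq x t 0 = x := rfl

/-- Second coordinate of `sq x t`. [folklore] -/
@[simp] theorem sq_one (x t : I) : sq x t 1 = t := rfl

/-- `sq` is continuous. [folklore] -/
theorem continuous_sq : Continuous fun p : I × I ↦ sq p.1 p.2 :=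
  continuous_pi fun i ↦ by
    fin_cases i
    · exact continuous_fst
    · exact continuous_snd

/-- Every point of `Fin 2 → I` is of the form `sq x t`. [folklore] -/
theorem sq_eta (y : Fin 2 → I) : sq (y 0) (y 1) = y := by
  ext i
  fin_cases i <;> rfl

/-- The bottom edge lies in the boundary of the square. [folklore] -/
theorem sq_zero_mem_boundary (x : I) : sq x 0 ∈ Cube.boundary (Fin 2) := ⟨1, Or.inl rfl⟩

/-- The top edge lies in the boundary of the square. [folklore] -/
theorem sq_one_mem_boundary (x : I) : sq x 1 ∈ Cube.boundary (Fin 2) := ⟨1, Or.inr rfl⟩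

/-- The left edge lies in the boundary of the square. [folklore] -/
theorem sq_left_mem_boundary (t : I) : sq 0 t ∈ Cube.boundary (Fin 2) := ⟨0, Or.inl rfl⟩

/-- The right edge lies in the boundary of the square. [folklore] -/
theorem sq_right_mem_boundary (t : I) : sq 1 t ∈ Cube.boundary (Fin 2) := ⟨0, Or.inr rfl⟩

/-- **The boundary loop, cosine part**: the real part of `q(y) = (1 - y₁) e^{2π i y₀} + y₁`, a map
of the square onto the closed unit disc taking the bottom edge once around the unit circle and
the three other edges to `1`. [folklore] -/
def bc (y : Fin 2 → I) : ℝ := (1 - (y 1 : ℝ)) * Real.cos (2 * Real.pi * y 0) + y 1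

/-- **The boundary loop, sine part**: the imaginary part of `q(y) = (1 - y₁) e^{2π i y₀} + y₁`. [folklore] -/
def bs (y : Fin 2 → I) : ℝ := (1 - (y 1 : ℝ)) * Real.sin (2 * Real.pi * y 0)

/-- `bc` is continuous. [folklore] -/
theorem continuous_bc : Continuous bc := by
  unfold bc; fun_prop

/-- `bs` is continuous. [folklore] -/
theorem continuous_bs : Continuous bs := by
  unfold bs; fun_prop

/-- On the bottom edge the boundary loop is the unit circle `(cos 2πx, sin 2πx)`. [folklore] -/
theorem bc_bs_of_bottom {y : Fin 2 → I} (h : y 1 = 0) :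
    bc y = Real.cos (2 * Real.pi * y 0) ∧ bs y = Real.sin (2 * Real.pi * y 0) := by
  simp [bc, bs, h]

/-- Off the bottom edge, the boundary loop is constant `= (1, 0)` on the boundary of the square.
[folklore] -/
theorem bc_bs_of_not_bottom {y : Fin 2 → I} (hy : y ∈ Cube.boundary (Fin 2)) (h : y 1 ≠ 0) :
    bc y = 1 ∧ bs y = 0 := by
  rcases Fin.exists_fin_two.1 hy with hi | hi
  · have hc : Real.cos (2 * Real.pi * y 0) = 1 ∧ Real.sin (2 * Real.pi * y 0) = 0 := by
      rcases hi with h0 | h0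
      · simp [h0]
      · simp [h0]
    refine ⟨?_, ?_⟩
    · rw [bc, hc.1]; ring
    · rw [bs, hc.2, mul_zero]
  · rcases hi with h1 | h1
    · exact absurd h1 h
    · simp [bc, bs, h1]

/-- On the boundary of the square the boundary loop lies on the unit circle. [folklore] -/
theorem bc_sq_add_bs_sq {y : Fin 2 → I} (hy : y ∈ Cube.boundary (Fin 2)) :
    bc y ^ 2 + bs y ^ 2 = 1 := by
  by_cases h : y 1 = 0
  · obtain ⟨h1, h2⟩ := bc_bs_of_bottom h
    rw [h1, h2, Real.cos_sq_add_sin_sq]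
  · obtain ⟨h1, h2⟩ := bc_bs_of_not_bottom hy h
    rw [h1, h2]; norm_num

/-! ### The base case: the rotation loop is essential in `GL₃(ℝ)` -/

/-- `(rotY c s)ᵀ rotY c s = 1` for `c² + s² = 1`. [folklore] -/
theorem transpose_rotY_mul_self {c s : ℝ} (h : c ^ 2 + s ^ 2 = 1) :
    (rotY c s)ᵀ * rotY c s = 1 := by
  ext i j
  fin_cases i <;> fin_cases j <;>
    simp [rotY, Matrix.mul_apply, Fin.sum_univ_three] <;> nlinarith [h]

/-- `det (rotY c s) = c² + s²`. [folklore] -/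
theorem det_rotY (c s : ℝ) : (rotY c s).det = c ^ 2 + s ^ 2 := by
  simp [rotY, Matrix.det_fin_three]; ring

/-- `rotY 1 0 = 1`. [folklore] -/
@[simp] theorem rotY_one_zero : rotY 1 0 = 1 := by
  ext i j
  fin_cases i <;> fin_cases j <;> simp [rotY]

/-- `rotY` is continuous in `(c, s)`. [folklore] -/
theorem continuous_rotY : Continuous fun p : ℝ × ℝ ↦ rotY p.1 p.2 := by
  refine continuous_matrix fun i j ↦ ?_
  fin_cases i <;> fin_cases j <;> simp [rotY] <;> fun_prop

/-- The rotation `rotY c s` as an element of `SO(3)`, `c² + s² = 1`. [folklore] -/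
def rotYSO3 (c s : ℝ) (h : c ^ 2 + s ^ 2 = 1) : SO3 :=
  ⟨rotY c s, transpose_rotY_mul_self h, by rw [det_rotY, h]⟩

/-- The matrix of `rotYSO3 c s h` is `rotY c s`. [folklore] -/
@[simp] theorem coe_rotYSO3 (c s : ℝ) (h : c ^ 2 + s ^ 2 = 1) : (rotYSO3 c s h).1 = rotY c s := rfl

/-- `rotYSO3 1 0 = 1`. [folklore] -/
theorem rotYSO3_one_zero (h : (1 : ℝ) ^ 2 + 0 ^ 2 = 1) : rotYSO3 1 0 h = 1 :=
  Subtype.ext (by simp)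

/-- **The explicit lift of the rotation loop to `S³`**: `x ↦ cos(πx) + sin(πx) j`, a path from
`1` to `-1` covering `x ↦ rotY (cos 2πx) (sin 2πx)` (half-angle formulas). [cite: HatcherAT2002, §3.D (φ sends x to the rotation through angle |x|π about the axis x)] -/
def liftY (x : I) : Quaternion ℝ :=
  (Real.cos (Real.pi * x) : Quaternion ℝ) + (Real.sin (Real.pi * x) : Quaternion ℝ) * ⟨0, 0, 1, 0⟩

/-- Components of `liftY x`. [folklore] -/
theorem liftY_re (x : I) : (liftY x).re = Real.cos (Real.pi * x) := by simp [liftY]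

/-- Components of `liftY x`. [folklore] -/
theorem liftY_imI (x : I) : (liftY x).imI = 0 := by simp [liftY]

/-- Components of `liftY x`. [folklore] -/
theorem liftY_imJ (x : I) : (liftY x).imJ = Real.sin (Real.pi * x) := by simp [liftY]

/-- Components of `liftY x`. [folklore] -/
theorem liftY_imK (x : I) : (liftY x).imK = 0 := by simp [liftY]

/-- `liftY` is continuous. [folklore] -/
theorem continuous_liftY : Continuous liftY := by
  unfold liftY
  refine ((Quaternion.continuous_coe.comp (by fun_prop)).add
    ((Quaternion.continuous_coe.comp (by fun_prop)).mul continuous_const))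

/-- `liftY x` is a unit quaternion. [folklore] -/
theorem liftY_mem (x : I) : liftY x ∈ Metric.sphere (0 : Quaternion ℝ) 1 :=
  mem_sphere_of_sq_add_sq (Real.cos_sq_add_sin_sq (Real.pi * x)) _
    (by rw [Quaternion.normSq_def', liftY_re, liftY_imI, liftY_imJ, liftY_imK]; ring)

/-- **Half-angle formula**: `rotHom (liftY x) = rotY (cos 2πx) (sin 2πx)`. [cite: HatcherAT2002, §3.D (φ sends x to the rotation through angle |x|π about the axis x)] -/
theorem rotHom_liftY (x : I) :
    (rotHom ⟨liftY x, liftY_mem x⟩).1 =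
      rotY (Real.cos (2 * Real.pi * x)) (Real.sin (2 * Real.pi * x)) := by
  rw [coe_rotHom]
  have h2 : (2 : ℝ) * Real.pi * x = 2 * (Real.pi * x) := by ring
  have hc : Real.cos (2 * Real.pi * x) = Real.cos (Real.pi * x) ^ 2 - Real.sin (Real.pi * x) ^ 2 := by
    rw [h2, Real.cos_two_mul]
    nlinarith [Real.sin_sq_add_cos_sq (Real.pi * x)]
  have hs : Real.sin (2 * Real.pi * x) = 2 * (Real.cos (Real.pi * x) * Real.sin (Real.pi * x)) := by
    rw [h2, Real.sin_two_mul]; ring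
  have h1 : Real.cos (Real.pi * x) ^ 2 + Real.sin (Real.pi * x) ^ 2 = 1 := Real.cos_sq_add_sin_sq _
  ext i j
  fin_cases i <;> fin_cases j <;>
    simp [quatRot, rotY, liftY_re, liftY_imI, liftY_imJ, liftY_imK, hc, hs, h1]

/-- `liftY 0 = 1` in `ℍ`. [folklore] -/
theorem liftY_zero' : liftY 0 = 1 := by
  simp [liftY]

/-- `liftY 1 = -1` in `ℍ`. [folklore] -/
theorem liftY_one' : liftY 1 = -1 := by
  simp [liftY]

/-- `liftY 0 = 1` in `S³`. [folklore] -/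
theorem liftY_zero : (⟨liftY 0, liftY_mem 0⟩ : Metric.sphere (0 : Quaternion ℝ) 1) = 1 := by
  apply Subtype.ext
  simp [Metric.unitSphere.coe_one, liftY_zero']

/-- `liftY 1 = -1` in `S³`. [folklore] -/
theorem liftY_one : (⟨liftY 1, liftY_mem 1⟩ : Metric.sphere (0 : Quaternion ℝ) 1) = -1 := by
  apply Subtype.ext
  simp [Metric.unitSphere.coe_one, liftY_one']

/-- **Base case: the rotation loop is essential in `GL₃(ℝ)`.** There is no continuous
`C : I² → GL₃(ℝ)` whose boundary values are the loop `rotY (bc y) (bs y)` (one full turn about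
the second axis along the bottom edge, the identity on the other three edges). Proof: `det C > 0`
(connectedness), so the Gram–Schmidt retraction `GL⁺(3, ℝ) → SO(3)`
(`Literature.AlgebraicTopology.FundamentalGroup.GLPos3.retr`), which fixes the rotations on the
boundary, turns `C` into a null-homotopy rel end points in `SO(3)` of `x ↦ rotY (cos 2πx) (sin 2πx)`;
but the lift of this loop through the covering `S³ → SO(3)`
(`Literature.AlgebraicTopology.FundamentalGroup.isCoveringMap_rotHom`) is `x ↦ cos(πx) + sin(πx) j`,
from `1` to `-1 ≠ 1`, while lifts of homotopic paths have the same end point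
(`IsCoveringMap.liftPath_apply_one_eq_of_homotopicRel`). Hatcher, *Algebraic Topology*, §3.D
("the universal cover `S³ → SO(3)`", `π₁(SO(3)) ≅ ℤ₂` generated by a rotation loop) and
Prop. 1.30. [cite: HatcherAT2002, §3.D (SO(3) ≈ ℝP³, universal cover S³ → SO(3)) and Prop. 1.30 (homotopy lifting)] -/
theorem base {C : (Fin 2 → I) → Matrix (Fin 3) (Fin 3) ℝ} (hC : Continuous C)
    (hdet : ∀ y, (C y).det ≠ 0)
    (hbd : ∀ y ∈ Cube.boundary (Fin 2), C y = rotY (bc y) (bs y)) : False := by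
  -- `det C > 0`: `= 1` on the boundary, never zero on the connected square
  have hdetbd : ∀ y ∈ Cube.boundary (Fin 2), (C y).det = 1 := fun y hy ↦ by
    rw [hbd y hy, det_rotY, bc_sq_add_bs_sq hy]
  have hpos : ∀ y, 0 < (C y).det := by
    intro y
    by_contra h
    rw [not_lt] at h
    have hcont : Continuous fun y ↦ (C y).det := hC.matrix_det
    have hsub := intermediate_value_univ y (sq 0 0) hcont
    have h0 : (0 : ℝ) ∈ Icc (C y).det (C (sq 0 0)).det :=
      ⟨h, by rw [hdetbd _ (sq_left_mem_boundary 0)]; exact zero_le_one⟩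
    obtain ⟨z, hz⟩ := hsub h0
    exact hdet z hz
  -- the retraction to `SO(3)` fixes the boundary rotations
  let Cs : (Fin 2 → I) → SO3 := fun y ↦ GLPos3.retr ⟨C y, hpos y⟩
  have hCs : Continuous Cs := GLPos3.retr.continuous.comp (hC.subtype_mk _)
  have hCsbd : ∀ y (hy : y ∈ Cube.boundary (Fin 2)),
      Cs y = rotYSO3 (bc y) (bs y) (bc_sq_add_bs_sq hy) := by
    intro y hy
    have h1 : (⟨C y, hpos y⟩ : GLPos3) = GLPos3.incl (rotYSO3 (bc y) (bs y) (bc_sq_add_bs_sq hy)) :=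
      Subtype.ext (hbd y hy)
    simp only [Cs, h1, GLPos3.retr_incl]
  -- the rotation loop in `SO(3)` and its null-homotopy rel end points
  have hγc : Continuous fun x : I ↦
      rotY (Real.cos (2 * Real.pi * x)) (Real.sin (2 * Real.pi * x)) :=
    continuous_rotY.comp (by fun_prop : Continuous fun x : I ↦
      (Real.cos (2 * Real.pi * (x : ℝ)), Real.sin (2 * Real.pi * (x : ℝ))))
  let γ : C(I, SO3) := ⟨fun x ↦ rotYSO3 (Real.cos (2 * Real.pi * x)) (Real.sin (2 * Real.pi * x))
      (Real.cos_sq_add_sin_sq _), hγc.subtype_mk _⟩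
  have hγ : ∀ x, γ x = rotYSO3 (Real.cos (2 * Real.pi * x)) (Real.sin (2 * Real.pi * x))
      (Real.cos_sq_add_sin_sq _) := fun _ ↦ rfl
  have hγ0 : γ 0 = 1 := by
    apply Subtype.ext; simp [hγ]
  have hγ1 : γ 1 = 1 := by
    apply Subtype.ext; simp [hγ]
  have hCs_sq : ∀ x t : I, sq x t ∈ Cube.boundary (Fin 2) → bc (sq x t) = 1 → bs (sq x t) = 0 →
      Cs (sq x t) = 1 := by
    intro x t hmem h1 h2
    rw [hCsbd _ hmem]
    apply Subtype.ext
    simp [h1, h2]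
  let F : C(I × I, SO3) := ⟨fun p ↦ Cs (sq p.2 p.1), hCs.comp (continuous_sq.comp continuous_swap)⟩
  have hF : ∀ t x, F (t, x) = Cs (sq x t) := fun _ _ ↦ rfl
  let Hrel : γ.HomotopyRel (ContinuousMap.const I (1 : SO3)) {0, 1} :=
    { toContinuousMap := F
      map_zero_left := fun x ↦ by
        show F (0, x) = γ x
        rw [hF, hCsbd _ (sq_zero_mem_boundary x), hγ]
        apply Subtype.ext
        obtain ⟨h1, h2⟩ := bc_bs_of_bottom (y := sq x 0) rfl
        simp [h1, h2]
      map_one_left := fun x ↦ by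
        show F (1, x) = (ContinuousMap.const I (1 : SO3)) x
        rw [hF, ContinuousMap.const_apply]
        refine hCs_sq x 1 (sq_one_mem_boundary x) ?_ ?_ <;> simp [bc, bs]
      prop' := fun t x hx ↦ by
        show F (t, x) = γ x
        rcases hx with rfl | rfl
        · rw [hγ0, hF]
          refine hCs_sq 0 t (sq_left_mem_boundary t) ?_ ?_ <;> simp [bc, bs]
        · rw [hγ1, hF]
          refine hCs_sq 1 t (sq_right_mem_boundary t) ?_ ?_ <;> simp [bc, bs] }
  -- lifting through the covering `S³ → SO(3)`
  have hcov := isCoveringMap_rotHom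
  have h0 : γ 0 = rotHom 1 := by rw [map_one, hγ0]
  have h1 : (ContinuousMap.const I (1 : SO3)) 0 = rotHom 1 := by rw [map_one]; rfl
  have key := hcov.liftPath_apply_one_eq_of_homotopicRel ⟨Hrel⟩ 1 h0 h1
  have hconst : hcov.liftPath (ContinuousMap.const I (1 : SO3)) 1 h1 = ContinuousMap.const I 1 :=
    hcov.liftPath_const _
  have hlift : (fun x ↦ (⟨liftY x, liftY_mem x⟩ : Metric.sphere (0 : Quaternion ℝ) 1)) =
      hcov.liftPath γ 1 h0 := by
    refine (hcov.eq_liftPath_iff h0).2 ⟨continuous_liftY.subtype_mk _, ?_, liftY_zero⟩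
    funext x
    apply Subtype.ext
    rw [Function.comp_apply, rotHom_liftY, hγ, coe_rotYSO3]
  have hend : hcov.liftPath γ 1 h0 1 = -1 := by
    rw [← hlift]; exact liftY_one
  rw [hend, hconst, ContinuousMap.const_apply] at key
  exact one_ne_neg_one_sphere key.symm

/-! ### The stabilised rotation loop and the induction over the dimension -/

/-- **The stabilised rotation** `rotBlock n c s = rotY c s ⊕ 1 ⊕ ⋯ ⊕ 1 ∈ Mₙ₊₃(ℝ)`: the rotation
with cosine `c` and sine `s` in the plane of the first and third coordinates, the identity on all
other coordinates. [folklore] -/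
def rotBlock : (n : ℕ) → ℝ → ℝ → Matrix (Fin (n + 3)) (Fin (n + 3)) ℝ
  | 0 => rotY
  | n + 1 => fun c s ↦ embed (rotBlock n c s)

/-- `rotBlock 0 = rotY`. [folklore] -/
@[simp] theorem rotBlock_zero (c s : ℝ) : rotBlock 0 c s = rotY c s := rfl

/-- `rotBlock (n + 1) = embed ∘ rotBlock n`. [folklore] -/
@[simp] theorem rotBlock_succ (n : ℕ) (c s : ℝ) : rotBlock (n + 1) c s = embed (rotBlock n c s) := rfl

/-- `det (rotBlock n c s) = c² + s²`. [folklore] -/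
@[simp] theorem det_rotBlock (n : ℕ) (c s : ℝ) : (rotBlock n c s).det = c ^ 2 + s ^ 2 := by
  induction n with
  | zero => simp [det_rotY]
  | succ n ih => simp [ih]

/-- `rotBlock n 1 0 = 1`. [folklore] -/
@[simp] theorem rotBlock_one_zero (n : ℕ) : rotBlock n 1 0 = 1 := by
  induction n with
  | zero => simp
  | succ n ih => simp [ih]

/-- `rotBlock n` is continuous in `(c, s)`. [folklore] -/
theorem continuous_rotBlock (n : ℕ) : Continuous fun p : ℝ × ℝ ↦ rotBlock n p.1 p.2 := by
  induction n with
  | zero => exact continuous_rotY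
  | succ n ih => exact continuous_embed.comp ih

/-- **The rotation loop is essential in `GLₙ₊₃(ℝ)` (square form).** There is no continuous map
`G : I² → GLₙ₊₃(ℝ)` whose boundary values are `rotBlock n (bc y) (bs y)` — one full turn of the
coordinate rotation along the bottom edge, the identity on the three other edges. By induction on
`n`: the base case is `base` (`π₁(SO(3)) = ℤ/2` detects the loop), and `peel` lowers the dimension
by one as long as `π₂` of the sphere of the last column vanishes, i.e. in all dimensions `≥ 4`.
This is the statement that the generator of `π₁(SO(3)) ≅ ℤ/2` survives in
`π₁(SO(n)) ≅ π₁(GLₙ(ℝ))` for all `n ≥ 3` (Hatcher, *Algebraic Topology*, §3.D and Example 4.55;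
Steenrod, *The Topology of Fibre Bundles*, §22). [cite: HatcherAT2002, §4.2 Example 4.55 (πᵢ(O(n)) → πᵢ(O(n+1)) is an isomorphism for i < n − 1) and §3.D (π₁(SO(3)) = ℤ₂)] -/
theorem square_false (n : ℕ) {G : (Fin 2 → I) → Matrix (Fin (n + 3)) (Fin (n + 3)) ℝ}
    (hG : Continuous G) (hdet : ∀ y, (G y).det ≠ 0)
    (hbd : ∀ y ∈ Cube.boundary (Fin 2), G y = rotBlock n (bc y) (bs y)) : False := by
  induction n with
  | zero => exact base hG hdet hbd
  | succ n ih =>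
    obtain ⟨B, hB, hBdet, hBbd⟩ := peel (n := n + 3) (by omega) hG hdet
      (B₀ := fun y ↦ rotBlock n (bc y) (bs y)) hbd
    exact ih hB hBdet hBbd

/-! ### Corollaries: loop form and disc form -/

/-- `GLₘ(ℝ)` as the subspace `{det ≠ 0}` of `Mₘ(ℝ)`. [folklore] -/
abbrev GLMat (m : ℕ) : Type := {M : Matrix (Fin m) (Fin m) ℝ // M.det ≠ 0}

/-- The unit of `GLₘ(ℝ)`. [folklore] -/
def GLMat.one (m : ℕ) : GLMat m := ⟨1, by simp⟩

/-- **The stabilised rotation loop** `x ↦ rotY (cos 2πx) (sin 2πx) ⊕ 1_{n}` in `GLₙ₊₃(ℝ)`, based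
at `1`. [cite: HatcherAT2002, §3.D (π₁(SO(n)) for n ≥ 3, generated by a rotation loop)] -/
def rotLoop (n : ℕ) : Path (GLMat.one (n + 3)) (GLMat.one (n + 3)) where
  toFun x := ⟨rotBlock n (Real.cos (2 * Real.pi * x)) (Real.sin (2 * Real.pi * x)), by
    rw [det_rotBlock, Real.cos_sq_add_sin_sq]; exact one_ne_zero⟩
  continuous_toFun := ((continuous_rotBlock n).comp (by fun_prop : Continuous fun x : I ↦
      (Real.cos (2 * Real.pi * (x : ℝ)), Real.sin (2 * Real.pi * (x : ℝ))))).subtype_mk _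
  source' := by
    apply Subtype.ext
    simp [GLMat.one]
  target' := by
    apply Subtype.ext
    simp [GLMat.one]

/-- Values of the rotation loop. [folklore] -/
theorem coe_rotLoop (n : ℕ) (x : I) :
    (rotLoop n x).1 = rotBlock n (Real.cos (2 * Real.pi * x)) (Real.sin (2 * Real.pi * x)) := rfl

/-- **The rotation loop is essential in `GLₙ(ℝ)`, `n ≥ 3` (loop form).** The loop
`x ↦ rotY (cos 2πx) (sin 2πx) ⊕ 1` is not null-homotopic rel base point in `GLₙ₊₃(ℝ)`: it
represents the generator of `π₁(GLₙ₊₃(ℝ)) ≅ π₁(SO(n + 3)) ≅ ℤ/2` (Hatcher, *Algebraic Topology*,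
§3.D: `π₁(SO(n)) ≅ ℤ₂` for `n ≥ 3`, via `SO(3) ≈ ℝP³` and the fibrations `SO(n) → SO(n+1) → Sⁿ`,
Example 4.55). Only the non-triviality is formalised. [cite: HatcherAT2002, §3.D (π₁(SO(n)) = ℤ₂ for n ≥ 3) and §4.2 Example 4.55] -/
theorem not_homotopic_rotLoop_refl (n : ℕ) : ¬ (rotLoop n).Homotopic (Path.refl _) := by
  rintro ⟨F⟩
  refine square_false n (G := fun y ↦ (F (y 1, y 0)).1) ?_ (fun y ↦ (F (y 1, y 0)).2) ?_
  · exact continuous_subtype_val.comp (F.continuous.comp (by fun_prop))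
  · intro y hy
    by_cases h : y 1 = 0
    · obtain ⟨h1, h2⟩ := bc_bs_of_bottom h
      rw [h1, h2, h]
      show (F (0, y 0)).1 = _
      rw [F.apply_zero]
      rfl
    · obtain ⟨h1, h2⟩ := bc_bs_of_not_bottom hy h
      rw [h1, h2, rotBlock_one_zero]
      rcases Fin.exists_fin_two.1 hy with hi | hi
      · have hx : y 0 ∈ ({0, 1} : Set I) := by
          rcases hi with h0 | h0
          · exact Or.inl h0
          · exact Or.inr h0
        show (F (y 1, y 0)).1 = 1
        rw [F.eq_fst (y 1) hx]
        rcases hi with h0 | h0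
        · rw [h0]; show ((rotLoop n) 0).1 = 1; rw [(rotLoop n).source]; rfl
        · rw [h0]; show ((rotLoop n) 1).1 = 1; rw [(rotLoop n).target]; rfl
      · rcases hi with h1' | h1'
        · exact absurd h1' h
        · rw [h1']
          show (F (1, y 0)).1 = 1
          rw [F.apply_one]
          rfl

/-- **The rotation loop does not extend over the disc (disc form).** There is no continuous
`G : ℂ → GLₙ₊₃(ℝ)` whose restriction to the unit circle is the stabilised rotation loop
`c + is ↦ rotBlock n c s`. (Compose with the map `y ↦ (1 - y₁) e^{2π i y₀} + y₁` of the square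
onto the disc and apply `square_false`.) [cite: HatcherAT2002, §3.D (π₁(SO(n)) = ℤ₂ for n ≥ 3) and §4.2 Example 4.55] -/
theorem disc_false (n : ℕ) {G : ℂ → Matrix (Fin (n + 3)) (Fin (n + 3)) ℝ} (hG : Continuous G)
    (hdet : ∀ w, (G w).det ≠ 0)
    (hcirc : ∀ c s : ℝ, c ^ 2 + s ^ 2 = 1 → G (c + s * Complex.I) = rotBlock n c s) : False := by
  refine square_false n (G := fun y ↦ G (bc y + bs y * Complex.I)) (hG.comp ?_) (fun y ↦ hdet _)
    fun y hy ↦ hcirc _ _ (bc_sq_add_bs_sq hy)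
  exact ((Complex.continuous_ofReal.comp continuous_bc).add
    ((Complex.continuous_ofReal.comp continuous_bs).mul continuous_const))

/-- The explicit `5 × 5` form of `rotBlock 2 c s`: rotation in the plane of the coordinates `0`
and `2`, identity on the coordinates `1, 3, 4`. [folklore] -/
theorem rotBlock_two (c s : ℝ) :
    rotBlock 2 c s = !![c, 0, s, 0, 0; 0, 1, 0, 0, 0; -s, 0, c, 0, 0; 0, 0, 0, 1, 0; 0, 0, 0, 0, 1] := by
  ext i j
  fin_cases i <;> fin_cases j <;> rfl

end RotLoop

end Literature.AlgebraicTopology.FundamentalGroup
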